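import Summits.QuantumFields.QCD.Theses.NestedDissectionSea
import Summits.QuantumFields.QCD.Theorems.NestedDissectionSeaCoerciveSeaSmallBoxes

/-!
# Crux `CoerciveSea` (stmt-QuantumFields-13901), line `chirality-collapses-pseudospectrum` — glue:
# the windowed dilution clause (ii) survives SHRINKING the window (`ℓ' ≤ ℓ`) once the torus side exceeds `ℓ`

Lead c2, skeleton v8-c2. Clause (ii) of `NegativeCellsDilute`/`CoerciveSea` does not ask `δ_j ≥ 0`, so on tori too
small to populate every dyadic scale `j < J(ℓ)` the bound `Σ_{j<J} δ_j ≤ ε` says nothing about the partial sums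
`Σ_{j<J(ℓ')} δ_j`. On tori of side `> ℓ/a_k` every scale `j < J(ℓ)` is populated by the cube `s_i = b₀ 2^j`
(`b₀ 2^j ≤ ⌊ℓ/a_k⌋₊ < N`), whence `δ_j ≥ P(·) ≥ 0` there and the partial sums are monotone: (ii) at window `ℓ`
and size `R` implies (ii) at every window `ℓ' ∈ (0, ℓ]` and size `max R (ℓ + 1)`. Deterministic bookkeeping. [folklore]
-/

noncomputable section

open scoped BigOperators Classical
open MeasureTheory Filter Matrix
open Literature.MathematicalPhysics.QuantumLattice Literature.MathematicalPhysics.QuantumFieldTheory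
  Literature.Probability.LatticeModels

namespace Summit.QuantumFields.QCD.Cruxes.CoerciveSea.ChiralityCollapsesPseudospectrum

-- adapted from `Summit.QuantumFields.QCD.Theorems.NestedDissectionSeaCoerciveOfDilute.quenchedRatio_nonneg`
/-- The phase-quenched probability `(∫ 1_E · wt) / (∫ wt)` of any event under a non-negative weight is `≥ 0`
(Bochner integrals of non-negative functions are non-negative; `x / 0 = 0`). [folklore] -/
private theorem quenchedRatio_nonneg_aux {Ω : Type*} [MeasurableSpace Ω] (μ : Measure Ω) {wt : Ω → ℝ}
    (hwt : ∀ U, 0 ≤ wt U) (E : Ω → Prop) :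
    0 ≤ (∫ U, (if E U then (1 : ℝ) else 0) * wt U ∂μ) / (∫ U, wt U ∂μ) :=
  div_nonneg (integral_nonneg fun U => mul_nonneg (by split_ifs <;> norm_num) (hwt U))
    (integral_nonneg hwt)

-- adapted from `Summit.QuantumFields.QCD.Theorems.NestedDissectionSeaCoerciveOfDilute.windowDepth_mono`
/-- The window depth `J = log₂(⌊ℓ/a⌋₊ / b₀) + 1` is monotone in the physical window `ℓ`. [folklore] -/
private theorem windowDepth_mono_aux {a ℓ ℓ' : ℝ} (ha : 0 < a) (hℓ : ℓ' ≤ ℓ) (b₀ : ℕ) :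
    Nat.log 2 (⌊ℓ' / a⌋₊ / b₀) + 1 ≤ Nat.log 2 (⌊ℓ / a⌋₊ / b₀) + 1 :=
  Nat.succ_le_succ (Nat.log_mono_right (Nat.div_le_div_right
    (Nat.floor_le_floor (div_le_div_of_nonneg_right hℓ ha.le))))

-- adapted from `Summit.QuantumFields.QCD.Theorems.NestedDissectionSeaCoerciveOfDilute.scaleBox_admissible`
/-- **Every positive dyadic scale below the window depth carries an admissible box** on a torus at least one
window wide (`ℓ ≤ a N`): for `1 ≤ j < J` the cube of side `b₀ 2^j` has `b₀ 2^j < b₀ 2^(j+2)`, `b₀ 2^j ≤ N`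
and `b₀ 2^j · a ≤ ℓ` (from `2^j ≤ 2^{log₂ q} ≤ q = ⌊ℓ/a⌋₊/b₀`, where `q ≥ 1` because `log₂ q ≥ j ≥ 1`, and
`b₀ q ≤ ⌊ℓ/a⌋₊ ≤ ℓ/a ≤ N`). [folklore] -/
private theorem scaleBox_admissible_aux {a ℓ : ℝ} (ha : 0 < a) (hℓ : 0 ≤ ℓ) {b₀ : ℕ} (hb₀ : 1 ≤ b₀)
    {N : ℕ} (hN : ℓ ≤ a * N) {j : ℕ} (hj₁ : 1 ≤ j) (hj : j < Nat.log 2 (⌊ℓ / a⌋₊ / b₀) + 1) :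
    b₀ * 2 ^ j < b₀ * 2 ^ (j + 2) ∧ b₀ * 2 ^ j ≤ N ∧ ((b₀ * 2 ^ j : ℕ) : ℝ) * a ≤ ℓ := by
  have hj' : j ≤ Nat.log 2 (⌊ℓ / a⌋₊ / b₀) := Nat.lt_succ_iff.mp hj
  have hq : ⌊ℓ / a⌋₊ / b₀ ≠ 0 := by
    intro hq
    rw [hq, Nat.log_zero_right] at hj'
    omega
  have hpow : 2 ^ j ≤ ⌊ℓ / a⌋₊ / b₀ :=
    (Nat.pow_le_pow_right (by norm_num) hj').trans (Nat.pow_log_le_self 2 hq)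
  have hn : b₀ * 2 ^ j ≤ ⌊ℓ / a⌋₊ :=
    (Nat.mul_le_mul_left b₀ hpow).trans (Nat.mul_div_le _ _)
  have hnreal : ((b₀ * 2 ^ j : ℕ) : ℝ) ≤ ℓ / a :=
    (Nat.cast_le.mpr hn).trans (Nat.floor_le (div_nonneg hℓ ha.le))
  refine ⟨?_, ?_, ?_⟩
  · exact Nat.mul_lt_mul_of_pos_left (Nat.pow_lt_pow_right (by norm_num) (by omega)) hb₀
  · have h : ((b₀ * 2 ^ j : ℕ) : ℝ) ≤ N := hnreal.trans (by rwa [div_le_iff₀' ha])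
    exact_mod_cast h
  · rwa [le_div_iff₀ ha] at hnreal

/-- **Window shrinking for the dilution clause.** For fixed `N_f, reg, m, b₀ ≥ 1, 0 < ℓ' ≤ ℓ, R`: clause (ii)
(windowed local dilution, verbatim the crux's) at window `ℓ` on tori of physical side `≥ R` implies clause (ii) at
window `ℓ'` on tori of physical side `≥ max R (ℓ + 1)`. [folklore] -/
theorem dilution_windowShrink :
    ∀ (Nf : ℕ) (reg : QCDRegularisation Nf) (m : Fin Nf → ℝ) (b₀ : ℕ) (ℓ ℓ' R : ℝ), 1 ≤ b₀ → 0 < ℓ' → ℓ' ≤ ℓ →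
      (∀ ε : ℝ, 0 < ε → ∀ᶠ k : ℕ in Filter.atTop, ∀ S : ℕ, R ≤ reg.a k * (2 * S + 1) → let N : ℕ := 2 * S + 1; let mq : Fin Nf → ℝ := fun f => reg.mcrit k + reg.a k * m f / reg.Zm k; let wt : GaugeConfig 4 N (Matrix.specialUnitaryGroup (Fin 3) ℂ) → ℝ := fun U => ∏ f, ‖fermionDet (wilsonDirac (fundamentalRep (Fin 3)) U (mq f) 1)‖; let P : (GaugeConfig 4 N (Matrix.specialUnitaryGroup (Fin 3) ℂ) → Prop) → ℝ := fun E => (∫ U, (if E U then (1 : ℝ) else 0) * wt U ∂(wilsonMeasure (d := 4) (L := N) (fundamentalRep (Fin 3)) (reg.β k))) / (∫ U, wt U ∂(wilsonMeasure (d := 4) (L := N) (fundamentalRep (Fin 3)) (reg.β k))); let J : ℕ := Nat.log 2 (⌊ℓ / reg.a k⌋₊ / b₀) + 1; ∃ δ : ℕ → ℝ, ∑ j ∈ Finset.range J, δ j ≤ ε ∧ ∀ j < J, ∀ s : Fin 4 → ℕ, (∀ i, b₀ * 2 ^ j ≤ s i ∧ s i < b₀ * 2 ^ (j + 2) ∧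 s i ≤ N ∧ (s i : ℝ) * reg.a k ≤ ℓ) → P (fun U => ∃ f, IsSignDefect U (mq f) j s) ≤ δ j) →
      (∀ ε : ℝ, 0 < ε → ∀ᶠ k : ℕ in Filter.atTop, ∀ S : ℕ, max R (ℓ + 1) ≤ reg.a k * (2 * S + 1) → let N : ℕ := 2 * S + 1; let mq : Fin Nf → ℝ := fun f => reg.mcrit k + reg.a k * m f / reg.Zm k; let wt : GaugeConfig 4 N (Matrix.specialUnitaryGroup (Fin 3) ℂ) → ℝ := fun U => ∏ f, ‖fermionDet (wilsonDirac (fundamentalRep (Fin 3)) U (mq f) 1)‖; let P : (GaugeConfig 4 N (Matrix.specialUnitaryGroup (Fin 3) ℂ) → Prop) → ℝ := fun E => (∫ U, (if E U then (1 : ℝ) else 0) * wt U ∂(wilsonMeasure (d := 4) (L := N) (fundamentalRep (Fin 3)) (reg.β k))) / (∫ U, wt U ∂(wilsonMeasure (d := 4) (L := N) (fundamentalRep (Fin 3)) (reg.β k))); let J : ℕ := Nat.log 2 (⌊ℓ' / reg.a k⌋₊ / b₀) + 1; ∃ δ : ℕ → ℝ, ∑ j ∈ Finset.range J, δ j ≤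 ε ∧ ∀ j < J, ∀ s : Fin 4 → ℕ, (∀ i, b₀ * 2 ^ j ≤ s i ∧ s i < b₀ * 2 ^ (j + 2) ∧ s i ≤ N ∧ (s i : ℝ) * reg.a k ≤ ℓ') → P (fun U => ∃ f, IsSignDefect U (mq f) j s) ≤ δ j) := by
  intro Nf reg m b₀ ℓ ℓ' R hb₀ hℓ' hℓℓ' h ε hε
  filter_upwards [h ε hε] with k hk S hS
  have ha := reg.a_pos k
  have hR : R ≤ reg.a k * (2 * S + 1) := le_trans (le_max_left _ _) hS
  have hℓS : ℓ + 1 ≤ reg.a k * (2 * S + 1) := le_trans (le_max_right _ _) hS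
  have hk' := hk S hR
  dsimp only at hk' ⊢
  obtain ⟨δ, hsum, hδ⟩ := hk'
  have hℓ0 : 0 ≤ ℓ := hℓ'.le.trans hℓℓ'
  -- the torus is (more than) one window wide
  have hN : ℓ ≤ reg.a k * ((2 * S + 1 : ℕ) : ℝ) := by
    push_cast
    linarith
  have hJ := windowDepth_mono_aux ha hℓℓ' b₀
  -- every `δ j` with `J(ℓ') ≤ j < J(ℓ)` dominates a genuine probability (the cube `b₀ 2^j`), hence is `≥ 0`
  have hδnonneg : ∀ j ∈ Finset.range (Nat.log 2 (⌊ℓ / reg.a k⌋₊ / b₀) + 1),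
      j ∉ Finset.range (Nat.log 2 (⌊ℓ' / reg.a k⌋₊ / b₀) + 1) → 0 ≤ δ j := by
    intro j hj hj'
    rw [Finset.mem_range] at hj hj'
    have hj₁ : 1 ≤ j := by omega
    obtain ⟨hlt, hle, hwin⟩ := scaleBox_admissible_aux ha hℓ0 hb₀ hN hj₁ hj
    have hbox := hδ j hj (fun _ => b₀ * 2 ^ j) fun i => ⟨le_rfl, hlt, hle, hwin⟩
    exact le_trans (quenchedRatio_nonneg_aux _ (fun U => Finset.prod_nonneg fun f _ => norm_nonneg _) _) hbox
  refine ⟨δ, ?_, ?_⟩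
  · -- the shorter sum differs from the longer by non-negative terms
    exact le_trans (Finset.sum_le_sum_of_subset_of_nonneg (Finset.range_subset_range.mpr hJ) hδnonneg) hsum
  · -- boxes of the smaller window are boxes of the larger window, at scales `j < J(ℓ') ≤ J(ℓ)`
    intro j hj s hs
    exact hδ j (lt_of_lt_of_le hj hJ) s
      fun i => ⟨(hs i).1, (hs i).2.1, (hs i).2.2.1, (hs i).2.2.2.trans hℓℓ'⟩

/-! ## Appended 2026-08-16 (lead c3): THE COMPOSITION of the line, landed

The line's skeleton v9-c3 (tree `Cruxes/CoerciveSea/Lines/chirality_collapses_pseudospectrum.lean`) proves the crux BY NAME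
from two registered stubs, both of which are the content of EXISTING items of the route read along the physical branch; the
two theorems below record that composition sorry-free with the stubs as HYPOTHESES, verbatim their registered signatures:

* `hD`/`h₃` = `stub_pinnedDilutionOnPhysicalBranch` — the rank-2 crux `NegativeCellsDilute` (stmt-QuantumFields-13900) for a
  witness ON THE PHYSICAL BRANCH, i.e. with the extra conjunct `Filter.Tendsto reg.mcrit Filter.atTop (nhds 0)` after
  `HasAsymptoticScaling` (lead c1's repair of the doubler-branch exposure `separatorLaw_false_of_pin_of_cluster_neg_four`);
* `hL` = `stub_separatorLawLarge` — clause (i) of the hinge (`P_pq(HasSingularSeparator U m_f(k) s (t/s₀)) ≤ C t^α`) on LARGE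
  window boxes (all sides `≥ S₀`) in a sub-window `ℓ' ≤ ℓ`, for masses above `M₁ ≥ M₀`, along EVERY physical-branch
  regularisation carrying the body of `NegativeCellsDilute` — the content of the glue item `CoerciveOfDilute`
  (stmt-QuantumFields-14759, `NegativeCellsDilute → CoerciveSea`) read along the physical branch and off the small boxes (up to
  `S₀ ↔ 2^r b₀`, `ℓ' = min ℓ ℓ₁` it is the hypothesis of `coerciveOfDilute_of_largeLeafWegnerLaw` restricted to physical-branch
  regularisations).

Witness of `coerciveSea_of_pinnedDilutionOnBranch_of_separatorLawLarge`: `reg, M₁, b₀, ℓ'`; per mass tuple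
`R = max (max R₀ (ℓ + 1)) Rᴸ`, `α = αᴸ`, `C = Cᴸ + κ₀^{−α}`, `κ₀ = 4(1 − cos(π/2S₁))`, `S₁ = max 1 S₀ᴸ`. Clause (i): large boxes —
`hL`; small boxes — `smallBox_separatorLaw` (kinetic floor `> κ₀`, valence mass `> −κ₀/2` eventually on the physical branch by
`tendsto_valenceMass`). Clause (ii): `hD`'s at window `ℓ`, shrunk to `ℓ'` by `dilution_windowShrink` above. Clause (iii): `hD`'s.

PLANNER-FACING MEANING (D-0014): with `coerciveSea_iff_negativeCellsDilute_and_coerciveOfDilute` (13901 = 13900 ∧ 14759) and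
this theorem, 13901 has no content beyond two self-contained statements that are strengthened readings of existing items:
restate 13900 with the branch conjunct and 14759 to the signature of `hL` verbatim, and 13901 closes by this theorem the
moment both close. Standard material; no Theses statement is asserted unconditionally. [folklore] -/

/-- **Forgetting the branch clause**: the physical-branch form of the pinned dilution (the registered import stub
`stub_pinnedDilutionOnPhysicalBranch` of line `chirality-collapses-pseudospectrum`) implies the route's
`NegativeCellsDilute` (stmt-QuantumFields-13900) verbatim — the reshaped import is a strengthening of item 13900, never a
weakening. [folklore] -/
theorem negativeCellsDilute_of_pinnedDilutionOnBranch
    (hD : ∀ Nf : ℕ, (Nf = 2 ∨ Nf = 3) → ∃ reg : QCDRegularisation Nf, reg.HasMassScaling ∧ (reg.scheme 0 0 0).HasAsymptoticScaling ∧ Filter.Tendsto reg.mcrit Filter.atTop (nhds 0) ∧ ∃ M₀ : ℝ, 0 ≤ M₀ ∧ ∃ b₀ : ℕ, 2 ≤ b₀ ∧ ∃ ℓ : ℝ, 0 < ℓ ∧ ∀ m : Fin Nf → ℝ, (∀ f, M₀ < m f) → ∃ R : ℝ, 0 < R ∧ (∀ ε : ℝ, 0 < ε → ∀ᶠ k :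 ℕ in Filter.atTop, ∀ S : ℕ, R ≤ reg.a k * (2 * S + 1) → let N : ℕ := 2 * S + 1; let mq : Fin Nf → ℝ := fun f => reg.mcrit k + reg.a k * m f / reg.Zm k; let wt : GaugeConfig 4 N (Matrix.specialUnitaryGroup (Fin 3) ℂ) → ℝ := fun U => ∏ f, ‖fermionDet (wilsonDirac (fundamentalRep (Fin 3)) U (mq f) 1)‖; let P : (GaugeConfig 4 N (Matrix.specialUnitaryGroup (Fin 3) ℂ) → Prop) → ℝ := fun E => (∫ U, (if E U then (1 : ℝ) else 0) * wt U ∂(wilsonMeasure (d := 4) (L := N) (fundamentalRep (Fin 3)) (reg.β k))) / (∫ U, wt U ∂(wilsonMeasure (d := 4) (L := N) (fundamentalRep (Fin 3)) (reg.β k))); let J : ℕ := Nat.log 2 (⌊ℓ / reg.a k⌋₊ / b₀) + 1; ∃ δ : ℕ → ℝ, ∑ j ∈ Finset.range J, δ j ≤ ε ∧ ∀ j < J, ∀ s : Fin 4 → ℕ, (∀ i, b₀ * 2 ^ j ≤ s i ∧ s i < b₀ * 2 ^ (j + 2) ∧ s i ≤ N ∧ (s i : ℝ) * reg.a k ≤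 ℓ) → P (fun U => ∃ f, IsSignDefect U (mq f) j s) ≤ δ j) ∧ (∀ M : ℝ, M₀ < M → ∀ᶠ k : ℕ in Filter.atTop, ∀ S : ℕ, R ≤ reg.a k * (2 * S + 1) → let N : ℕ := 2 * S + 1; let mq : Fin Nf → ℝ := fun f => reg.mcrit k + reg.a k * m f / reg.Zm k; let wt : GaugeConfig 4 N (Matrix.specialUnitaryGroup (Fin 3) ℂ) → ℝ := fun U => ∏ f, ‖fermionDet (wilsonDirac (fundamentalRep (Fin 3)) U (mq f) 1)‖; (1 / 4 : ℝ) ≤ (∫ U, (if (fermionDet (wilsonDirac (fundamentalRep (Fin 3)) U (reg.mcrit k - reg.a k * M / reg.Zm k) 1)).re < 0 then (1 : ℝ) else 0) * wt U ∂(wilsonMeasure (d := 4) (L := N) (fundamentalRep (Fin 3)) (reg.β k))) / (∫ U, wt U ∂(wilsonMeasure (d := 4) (L := N) (fundamentalRep (Fin 3)) (reg.β k))))) :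
    Summit.QuantumFields.QCD.Theses.NestedDissectionSea.NegativeCellsDilute := by
  intro Nf hNf
  obtain ⟨reg, hms, has, -, rest⟩ := hD Nf hNf
  exact ⟨reg, hms, has, rest⟩

/-- **THE COMPOSITION of line `chirality-collapses-pseudospectrum` (skeleton v9-c3), landed.** The hinge `CoerciveSea`
(stmt-QuantumFields-13901) follows from (`hD`) the pinned windowed dilution of `NegativeCellsDilute` for a physical-branch
witness (item 13900 + the conjunct `mcrit k → 0`) and (`hL`) the separator Wegner law on large window boxes in a
sub-window along every physical-branch pinned-dilute regularisation (the content of item 14759 on the physical branch) —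
hypotheses VERBATIM the registered stub signatures. Proof: witness `reg, M₁, b₀, ℓ'`; clause (i) splits into large boxes
(`hL`) and small boxes (`smallBox_separatorLaw`, deterministic: below the kinetic floor the event is empty, and the
valence masses clear `−κ₀/2` eventually on the physical branch); clause (ii) is `hD`'s shrunk to the sub-window by
`dilution_windowShrink`; clause (iii) is `hD`'s. [folklore] -/
theorem coerciveSea_of_pinnedDilutionOnBranch_of_separatorLawLarge
    (h₃ : ∀ Nf : ℕ, (Nf = 2 ∨ Nf = 3) → ∃ reg : QCDRegularisation Nf, reg.HasMassScaling ∧ (reg.scheme 0 0 0).HasAsymptoticScaling ∧ Filter.Tendsto reg.mcrit Filter.atTop (nhds 0) ∧ ∃ M₀ : ℝ, 0 ≤ M₀ ∧ ∃ b₀ : ℕ, 2 ≤ b₀ ∧ ∃ ℓ : ℝ, 0 < ℓ ∧ ∀ m : Fin Nf → ℝ, (∀ f, M₀ < m f) → ∃ R : ℝ, 0 < R ∧ (∀ ε : ℝ, 0 < ε → ∀ᶠ k : ℕ in Filter.atTop, ∀ S : ℕ, R ≤ reg.a k * (2 * S + 1) → let N : ℕ := 2 * S + 1; let mq : Fin Nf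 → ℝ := fun f => reg.mcrit k + reg.a k * m f / reg.Zm k; let wt : GaugeConfig 4 N (Matrix.specialUnitaryGroup (Fin 3) ℂ) → ℝ := fun U => ∏ f, ‖fermionDet (wilsonDirac (fundamentalRep (Fin 3)) U (mq f) 1)‖; let P : (GaugeConfig 4 N (Matrix.specialUnitaryGroup (Fin 3) ℂ) → Prop) → ℝ := fun E => (∫ U, (if E U then (1 : ℝ) else 0) * wt U ∂(wilsonMeasure (d := 4) (L := N) (fundamentalRep (Fin 3)) (reg.β k))) / (∫ U, wt U ∂(wilsonMeasure (d := 4) (L := N) (fundamentalRep (Fin 3)) (reg.β k))); let J : ℕ := Nat.log 2 (⌊ℓ / reg.a k⌋₊ / b₀) + 1; ∃ δ : ℕ → ℝ, ∑ j ∈ Finset.range J, δ j ≤ ε ∧ ∀ j < J, ∀ s : Fin 4 → ℕ, (∀ i, b₀ * 2 ^ j ≤ s i ∧ s i < b₀ * 2 ^ (j + 2) ∧ s i ≤ N ∧ (s i : ℝ) * reg.a k ≤ ℓ) → P (fun U => ∃ f, IsSignDefect U (mq f) j s) ≤ δ j) ∧ (∀ M : ℝ, M₀ < M → ∀ᶠ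 k : ℕ in Filter.atTop, ∀ S : ℕ, R ≤ reg.a k * (2 * S + 1) → let N : ℕ := 2 * S + 1; let mq : Fin Nf → ℝ := fun f => reg.mcrit k + reg.a k * m f / reg.Zm k; let wt : GaugeConfig 4 N (Matrix.specialUnitaryGroup (Fin 3) ℂ) → ℝ := fun U => ∏ f, ‖fermionDet (wilsonDirac (fundamentalRep (Fin 3)) U (mq f) 1)‖; (1 / 4 : ℝ) ≤ (∫ U, (if (fermionDet (wilsonDirac (fundamentalRep (Fin 3)) U (reg.mcrit k - reg.a k * M / reg.Zm k) 1)).re < 0 then (1 : ℝ) else 0) * wt U ∂(wilsonMeasure (d := 4) (L := N) (fundamentalRep (Fin 3)) (reg.β k))) / (∫ U, wt U ∂(wilsonMeasure (d := 4) (L := N) (fundamentalRep (Fin 3)) (reg.β k)))))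
    (hL : ∀ (Nf : ℕ) (reg : QCDRegularisation Nf), (Nf = 2 ∨ Nf = 3) → reg.HasMassScaling → (reg.scheme 0 0 0).HasAsymptoticScaling → Filter.Tendsto reg.mcrit Filter.atTop (nhds 0) → ∀ M₀ : ℝ, 0 ≤ M₀ → ∀ b₀ : ℕ, 2 ≤ b₀ → ∀ ℓ : ℝ, 0 < ℓ → (∀ m : Fin Nf → ℝ, (∀ f, M₀ < m f) → ∃ R : ℝ, 0 < R ∧ (∀ ε : ℝ, 0 < ε → ∀ᶠ k : ℕ in Filter.atTop, ∀ S : ℕ, R ≤ reg.a k * (2 * S + 1) → let N : ℕ := 2 * S + 1; let mq : Fin Nf → ℝ := fun f => reg.mcrit k + reg.a k * m f / reg.Zm k; let wt : GaugeConfig 4 N (Matrix.specialUnitaryGroup (Fin 3) ℂ) → ℝ := fun U => ∏ f, ‖fermionDet (wilsonDirac (fundamentalRep (Fin 3)) U (mq f) 1)‖; let P : (GaugeConfig 4 N (Matrix.specialUnitaryGroup (Fin 3) ℂ) → Prop) → ℝ := fun E => (∫ U, (if E U then (1 : ℝ) else 0) * wt U ∂(wilsonMeasure (d := 4) (L :=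 N) (fundamentalRep (Fin 3)) (reg.β k))) / (∫ U, wt U ∂(wilsonMeasure (d := 4) (L := N) (fundamentalRep (Fin 3)) (reg.β k))); let J : ℕ := Nat.log 2 (⌊ℓ / reg.a k⌋₊ / b₀) + 1; ∃ δ : ℕ → ℝ, ∑ j ∈ Finset.range J, δ j ≤ ε ∧ ∀ j < J, ∀ s : Fin 4 → ℕ, (∀ i, b₀ * 2 ^ j ≤ s i ∧ s i < b₀ * 2 ^ (j + 2) ∧ s i ≤ N ∧ (s i : ℝ) * reg.a k ≤ ℓ) → P (fun U => ∃ f, IsSignDefect U (mq f) j s) ≤ δ j) ∧ (∀ M : ℝ, M₀ < M → ∀ᶠ k : ℕ in Filter.atTop, ∀ S : ℕ, R ≤ reg.a k * (2 * S + 1) → let N : ℕ := 2 * S + 1; let mq : Fin Nf → ℝ := fun f => reg.mcrit k + reg.a k * m f / reg.Zm k; let wt : GaugeConfig 4 N (Matrix.specialUnitaryGroup (Fin 3) ℂ) → ℝ := fun U => ∏ f, ‖fermionDet (wilsonDirac (fundamentalRep (Fin 3)) U (mq f) 1)‖; (1 / 4 : ℝ) ≤ (∫ U, (if (fermionDet (wilsonDirac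 (fundamentalRep (Fin 3)) U (reg.mcrit k - reg.a k * M / reg.Zm k) 1)).re < 0 then (1 : ℝ) else 0) * wt U ∂(wilsonMeasure (d := 4) (L := N) (fundamentalRep (Fin 3)) (reg.β k))) / (∫ U, wt U ∂(wilsonMeasure (d := 4) (L := N) (fundamentalRep (Fin 3)) (reg.β k))))) → ∃ M₁ : ℝ, M₀ ≤ M₁ ∧ ∃ ℓ' : ℝ, 0 < ℓ' ∧ ℓ' ≤ ℓ ∧ ∀ m : Fin Nf → ℝ, (∀ f, M₁ < m f) → ∃ R : ℝ, 0 < R ∧ ∃ S₀ : ℕ, ∃ C : ℝ, 0 < C ∧ ∃ α : ℝ, 0 < α ∧ ∀ᶠ k : ℕ in Filter.atTop, ∀ S : ℕ, R ≤ reg.a k * (2 * S + 1) → let N : ℕ := 2 * S + 1; let mq : Fin Nf → ℝ := fun f => reg.mcrit k + reg.a k * m f / reg.Zm k; let wt : GaugeConfig 4 N (Matrix.specialUnitaryGroup (Fin 3) ℂ) → ℝ := fun U => ∏ f, ‖fermionDet (wilsonDirac (fundamentalRep (Fin 3)) U (mq f) 1)‖; let P : (GaugeConfig 4 N (Matrix.specialUnitaryGroup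 (Fin 3) ℂ) → Prop) → ℝ := fun E => (∫ U, (if E U then (1 : ℝ) else 0) * wt U ∂(wilsonMeasure (d := 4) (L := N) (fundamentalRep (Fin 3)) (reg.β k))) / (∫ U, wt U ∂(wilsonMeasure (d := 4) (L := N) (fundamentalRep (Fin 3)) (reg.β k))); ∀ s : Fin 4 → ℕ, (∀ i, b₀ ≤ s i ∧ s i ≤ N ∧ (s i : ℝ) * reg.a k ≤ ℓ') → (∀ i, S₀ ≤ s i) → (∀ i j, s i ≤ 2 * s j) → ∀ f : Fin Nf, ∀ t : ℝ, 0 < t → t ≤ 1 → P (fun U => HasSingularSeparator U (mq f) s (t / s 0)) ≤ C * t ^ α) :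
    Summit.QuantumFields.QCD.Theses.NestedDissectionSea.CoerciveSea := by
  have hW := dilution_windowShrink
  intro Nf hNf
  obtain ⟨reg, hms, has, hcrit, M₀, hM₀, b₀, hb₀, ℓ, hℓ, hm⟩ := h₃ Nf hNf
  obtain ⟨M₁, hM₁, ℓ', hℓ'0, hℓ'ℓ, hLaw⟩ := hL Nf reg hNf hms has hcrit M₀ hM₀ b₀ hb₀ ℓ hℓ hm
  refine ⟨reg, hms, has, M₁, le_trans hM₀ hM₁, b₀, hb₀, ℓ', hℓ'0, fun m hmm => ?_⟩
  have hm0 : ∀ f, M₀ < m f := fun f => lt_of_le_of_lt hM₁ (hmm f)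
  obtain ⟨R₀, hR₀, hDil, hPin⟩ := hm m hm0
  obtain ⟨RL, hRL, SL, CL, hCL, αL, hαL, hLk⟩ := hLaw m hmm
  -- the small-box scale `S₁` and its kinetic floor `κ₀`
  obtain ⟨S₁, hS₁1, hS₁L⟩ : ∃ S₁ : ℕ, 1 ≤ S₁ ∧ SL ≤ S₁ := ⟨max 1 SL, le_max_left _ _, le_max_right _ _⟩
  obtain ⟨κ₀, hκ₀def, hκ₀pos⟩ : ∃ κ₀ : ℝ, κ₀ = 4 * (1 - Real.cos (Real.pi / (2 * S₁))) ∧ 0 < κ₀ :=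
    ⟨_, rfl, kineticFloor_pos hS₁1⟩
  have hNf16 : Nf ≤ 16 := by rcases hNf with h | h <;> omega
  have hb₀1 : 1 ≤ b₀ := le_trans (by norm_num) hb₀
  -- clause (ii) at the shrunk window, from the import's clause (ii) at window `ℓ`
  have hDil' := hW Nf reg m b₀ ℓ ℓ' R₀ hb₀1 hℓ'0 hℓ'ℓ hDil
  refine ⟨max (max R₀ (ℓ + 1)) RL, lt_of_lt_of_le hR₀ (le_trans (le_max_left _ _) (le_max_left _ _)),
    ?_, ?_, ?_⟩
  · -- clause (i): the separator Wegner law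
    refine ⟨CL + κ₀ ^ (-αL), by positivity, αL, hαL, ?_⟩
    -- on the physical branch every valence mass is eventually above `−κ₀/2`
    have hmq : ∀ᶠ k : ℕ in Filter.atTop, ∀ f : Fin Nf, -(κ₀ / 2) < reg.mcrit k + reg.a k * m f / reg.Zm k := by
      refine Filter.eventually_all.mpr fun f => ?_
      exact (tendsto_valenceMass reg hms hNf16 hcrit m f).eventually_const_lt (by linarith)
    filter_upwards [hLk, hmq] with k hkL hkq
    intro S hS
    have hSL : RL ≤ reg.a k * (2 * S + 1) := le_trans (le_max_right _ _) hS
    have hL' := hkL S hSL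
    dsimp only at hL' ⊢
    intro s hs hcub f t ht0 ht1
    have h2s : ∀ i, 2 ≤ s i := fun i => le_trans hb₀ (hs i).1
    have hsN : ∀ i, s i ≤ 2 * S + 1 := fun i => (hs i).2.1
    have htα : 0 ≤ t ^ αL := Real.rpow_nonneg ht0.le _
    have hκα : 0 ≤ κ₀ ^ (-αL) := Real.rpow_nonneg hκ₀pos.le _
    by_cases hlarge : ∀ i, S₁ ≤ s i
    · -- LARGE boxes: the law
      have hlL : ∀ i, SL ≤ s i := fun i => le_trans hS₁L (hlarge i)
      have hLt := hL' s hs hlL hcub f t ht0 ht1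
      refine le_trans hLt ?_
      exact mul_le_mul_of_nonneg_right (le_add_of_nonneg_right hκα) htα
    · -- SMALL boxes: some side `< S₁` — the landed small-box half of clause (i) (`smallBox_separatorLaw`)
      push Not at hlarge
      have hq : -(4 * (1 - Real.cos (Real.pi / (2 * S₁))) / 2) < reg.mcrit k + reg.a k * m f / reg.Zm k := by
        rw [← hκ₀def]; exact hkq f
      have hC : (4 * (1 - Real.cos (Real.pi / (2 * S₁)))) ^ (-αL) ≤ CL + κ₀ ^ (-αL) := by
        rw [← hκ₀def]; linarith [hCL.le]
      exact smallBox_separatorLaw Nf (2 * S + 1) (reg.β k) (fun f' => reg.mcrit k + reg.a k * m f' / reg.Zm k) s S₁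
        (CL + κ₀ ^ (-αL)) αL t f hS₁1 hlarge (fun i => ⟨h2s i, hsN i⟩) hcub hq ht0 hαL hC
  · -- clause (ii): imported at window `ℓ`, shrunk to `ℓ'`, restricted to the larger physical size
    intro ε hε
    filter_upwards [hDil' ε hε] with k hk S hS
    exact hk S (le_trans (le_max_left _ _) hS)
  · -- clause (iii): imported, restricted to the larger size and threshold
    intro M hM
    have hM0 : M₀ < M := lt_of_le_of_lt hM₁ hM
    filter_upwards [hPin M hM0] with k hk S hS
    exact hk S (le_trans (le_trans (le_max_left _ _) (le_max_left _ _)) hS)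

end Summit.QuantumFields.QCD.Cruxes.CoerciveSea.ChiralityCollapsesPseudospectrum

end
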